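import Literature.NumberTheory.Sieve.QuadraticRootsPrimeModuliDFISieveMaster
import Literature.NumberTheory.Sieve.QuadraticRootsPrimeModuliDFISieveAsymptotics
import HarnessLib

/-!
# Duke–Friedlander–Iwaniec 1995, Theorem 5 — PROVED (`dukeFriedlanderIwaniec1995_theorem5_holds`)

Topic `Literature/NumberTheory/Sieve`.  Discharge of the named fact
`Literature.NumberTheory.Sieve.dukeFriedlanderIwaniec1995_theorem5` (`QuadraticRootsPrimeModuliDFI.lean`):
DFI's **Theorem 5** (W. Duke, J. B. Friedlander, H. Iwaniec, *Equidistribution of roots of a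
quadratic congruence to prime moduli*, Ann. of Math. 141 (1995), §6 p. 437) — for complex `c_n`,
`1 ≤ n ≤ x`, `|c_n| ≤ τ(n)`, the hypotheses (34) (special bilinear forms, level `D = x^{1/2−ε}`) and
(35) (general bilinear forms, `y = x^{1/3−ε}`, `w = x^{(log log x)^{−3}}`) give
`∑_{p ≤ x} c_p ≪ ε π(x)` for `x > x₀(ε)`, the implied constant absolute.

The proof is the paper's (§6, "Combinatorial identities", pp. 433–437), assembled from the companion
files: Buchstab twice and Legendre (`…DFISieveIdentities`, `…DFISieveReindex`, in the quotient
convention `S(C_d, z) = ∑_{(m,P(z))=1} c_{dm}` forced by Lemma 1), the crude bound (27) with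
`γ(d) = τ(d)/d`, `X = x(1 + log x)` and Rankin's trick (`…DFISieveEstimates`), the Legendre terms
against (34) (`…DFISieveLegendre`), the partition `y_k` (30) and the middle terms against (35)
(`…DFISievePartition`, `…DFISieveMiddle`), the terms `y ≤ p < q < z` and `S(C, z)` versus `∑ c_p`
(`…DFISieveRough`, `…DFISieveLeft`), combined in `DFI1995.norm_primeSum_le_master`
(`…DFISieveMaster`); the choices `z = x^{1/2−3ε/2}`, `K = ⌊log x⌋⁵` and the verification that
all remaining terms are `o(x/log x)` (`…DFISieveAsymptotics`) are made here, and Chebyshev's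
`x/log x ≪ π(x)` converts the bound.  For `ε > 1/24` the trivial bound `|∑_{p≤x} c_p| ≤ 2π(x) ≤ 48 ε π(x)`
is used instead (the statement restricts to `0 < ε ≤ 1/12`; its content is `ε → 0`).  The absolute
constant obtained is `max(48, 1207·C)` with `C` the Chebyshev constant of
`DFI1995.exists_eventually_div_log_le_primeCounting`.

## References

* W. Duke, J. B. Friedlander, H. Iwaniec, Ann. of Math. (2) 141 (1995), 423–441, §6 Theorem 5
  (p. 437) with (32)–(35) and Lemmas 1–3. [cite: DukeFriedlanderIwaniec1995, Theorem 5 p. 437]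
-/

namespace Literature.NumberTheory.Sieve

open scoped BigOperators
open Finset Real Filter

namespace DFI1995

noncomputable section

/-- The trivial bound `|∑_{p ≤ N} c_p| ≤ 2 π(N)` for `|c_n| ≤ τ(n)`. [folklore] -/
theorem norm_primeSum_le_two_mul_primeCounting {c : ℕ → ℂ}
    (hc : ∀ n : ℕ, 1 ≤ n → ‖c n‖ ≤ (Nat.divisors n).card) (N : ℕ) :
    ‖∑ p ∈ Nat.primesLE N, c p‖ ≤ 2 * (Nat.primeCounting N : ℝ) := by
  refine (norm_sum_le _ _).trans ?_
  have h : ∀ p ∈ Nat.primesLE N, ‖c p‖ ≤ 2 := fun p hp => by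
    have hpp := (Nat.mem_primesLE.1 hp).2
    calc ‖c p‖ ≤ (p.divisors.card : ℝ) := hc p hpp.one_le
      _ = 2 := by rw [Nat.Prime.divisors hpp, Finset.card_pair hpp.ne_one.symm]; norm_num
  calc ∑ p ∈ Nat.primesLE N, ‖c p‖ ≤ ∑ p ∈ Nat.primesLE N, (2 : ℝ) := Finset.sum_le_sum h
    _ = 2 * (Nat.primeCounting N : ℝ) := by
        rw [Finset.sum_const, nsmul_eq_mul, Nat.primesLE_card_eq_primeCounting, mul_comm]

/-- **The parameters of Theorem 5** for `0 < ε ≤ 1/24`, `x > 1`, `log x ≥ 16384²`: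
`w = x^{(log log x)^{−3}}`, `y = x^{1/3−ε}`, `z = x^{1/2−3ε/2}`, `D = x^{1/2−ε}` satisfy
`2 ≤ w < y ≤ z`, `4 ≤ z ≤ √x`, `x < z³`, `0 < D ≤ x`, with the expected logarithms.
[cite: DukeFriedlanderIwaniec1995, §6 p. 437 and Theorem 5] -/
theorem theorem5_params {ε x : ℝ} (hε : 0 < ε) (hε' : ε ≤ 1 / 24) (hx : 1 < x)
    (hbig : (16384 : ℝ) ^ 2 ≤ Real.log x) :
    (2 ≤ x ^ ((Real.log (Real.log x))⁻¹ ^ 3) ∧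
      x ^ ((Real.log (Real.log x))⁻¹ ^ 3) < x ^ (1 / 3 - ε) ∧
      x ^ (1 / 3 - ε) ≤ x ^ (1 / 2 - 3 * ε / 2) ∧
      4 ≤ x ^ (1 / 2 - 3 * ε / 2) ∧ x ^ (1 / 2 - 3 * ε / 2) ≤ Real.sqrt x ∧
      x < (x ^ (1 / 2 - 3 * ε / 2)) ^ 3 ∧ 0 < x ^ (1 / 2 - ε) ∧ x ^ (1 / 2 - ε) ≤ x) ∧
    (Real.log (x ^ (1 / 3 - ε)) = (1 / 3 - ε) * Real.log x ∧
      Real.log (x ^ ((Real.log (Real.log x))⁻¹ ^ 3)) = Real.log x / Real.log (Real.log x) ^ 3 ∧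
      Real.log (x ^ (1 / 2 - ε)) = (1 / 2 - ε) * Real.log x ∧
      Real.log (x ^ (1 / 2 - 3 * ε / 2)) = (1 / 2 - 3 * ε / 2) * Real.log x ∧
      0 < x ^ (1 / 3 - ε) ∧ 0 < x ^ (1 / 2 - 3 * ε / 2)) := by
  have hx0 : 0 < x := by linarith
  set L := Real.log x with hLdef
  have hL16 : 16 ≤ L := le_trans (by norm_num) hbig
  have hL0 : 0 < L := by linarith
  set L₂ := Real.log L with hL₂def
  have hL₂2 : 2 ≤ L₂ := two_le_log_of_sixteen_le hL16
  have hL₂0 : 0 < L₂ := by linarith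
  set w := x ^ ((Real.log (Real.log x))⁻¹ ^ 3) with hw
  set y := x ^ (1 / 3 - ε) with hy
  set z := x ^ (1 / 2 - 3 * ε / 2) with hz
  set D := x ^ (1 / 2 - ε) with hD
  have hw0 : 0 < w := Real.rpow_pos_of_pos hx0 _
  have hy0 : 0 < y := Real.rpow_pos_of_pos hx0 _
  have hz0 : 0 < z := Real.rpow_pos_of_pos hx0 _
  have hD0 : 0 < D := Real.rpow_pos_of_pos hx0 _
  have hlogw : Real.log w = L / L₂ ^ 3 := by
    rw [hw, Real.log_rpow hx0, ← hLdef, ← hL₂def, inv_pow]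
    field_simp
  have hlogy : Real.log y = (1 / 3 - ε) * L := by rw [hy, Real.log_rpow hx0]
  have hlogz : Real.log z = (1 / 2 - 3 * ε / 2) * L := by rw [hz, Real.log_rpow hx0]
  have hlogD : Real.log D = (1 / 2 - ε) * L := by rw [hD, Real.log_rpow hx0]
  -- `log w ≥ 4 L₂ ≥ 8` and `log w ≤ L/8`
  have h4 : 4 * L₂ ^ 4 ≤ L := four_mul_log_pow_four_le hbig
  have h8 : (8 : ℝ) ≤ L₂ ^ 3 := by
    have := pow_le_pow_left₀ (by norm_num : (0 : ℝ) ≤ 2) hL₂2 3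
    norm_num at this; exact this
  have hlogw_ge : 4 * L₂ ≤ Real.log w := by
    rw [hlogw, le_div_iff₀ (by positivity)]; nlinarith
  have hlogw_le : Real.log w ≤ L / 8 := by
    rw [hlogw]; exact div_le_div_of_nonneg_left hL0.le (by norm_num) h8
  refine ⟨⟨?_, ?_, ?_, ?_, ?_, ?_, hD0, ?_⟩, hlogy, hlogw, hlogD, hlogz, hy0, hz0⟩
  · -- `2 ≤ w`
    rw [← Real.log_le_log_iff (by norm_num) hw0]
    have : Real.log 2 ≤ 2 - 1 := Real.log_le_sub_one_of_pos two_pos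
    linarith
  · -- `w < y`
    rw [← Real.log_lt_log_iff hw0 hy0, hlogy]
    nlinarith
  · exact Real.rpow_le_rpow_of_exponent_le hx.le (by linarith)
  · -- `4 ≤ z`
    rw [← Real.log_le_log_iff (by norm_num) hz0, hlogz]
    have : Real.log 4 ≤ 4 - 1 := Real.log_le_sub_one_of_pos (by norm_num)
    nlinarith
  · rw [Real.sqrt_eq_rpow]
    exact Real.rpow_le_rpow_of_exponent_le hx.le (by linarith)
  · -- `x < z³`
    have e : z ^ 3 = x ^ ((1 / 2 - 3 * ε / 2) * 3) := by
      rw [hz, ← Real.rpow_natCast, ← Real.rpow_mul hx0.le]; norm_num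
    rw [e]
    calc x = x ^ (1 : ℝ) := (Real.rpow_one x).symm
      _ < x ^ ((1 / 2 - 3 * ε / 2) * 3) := Real.rpow_lt_rpow_of_exponent_lt hx (by linarith)
  · calc D = x ^ (1 / 2 - ε) := hD
      _ ≤ x ^ (1 : ℝ) := Real.rpow_le_rpow_of_exponent_le hx.le (by linarith)
      _ = x := Real.rpow_one x

end

end DFI1995

/-- **Duke–Friedlander–Iwaniec, Theorem 5 (PROVED)**: discharge of the named fact
`dukeFriedlanderIwaniec1995_theorem5` — the sieve for complex sequences `|c_n| ≤ τ(n)` producing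
`∑_{p ≤ x} c_p ≪ ε π(x)` (`x > x₀(ε)`, absolute implied constant) from the bilinear-form hypotheses
(34) with `D = x^{1/2−ε}` and (35) with `y = x^{1/3−ε}`, `w = x^{(log log x)^{−3}}`; proof as in §6 of
the paper (Buchstab twice, Legendre, (27) with Rankin's trick, the partition (30), Lemmas 1–3 and the
two estimates of p. 437), with `z = x^{1/2−3ε/2}`, `K = ⌊log x⌋⁵`, and the trivial bound for
`ε > 1/24`. [cite: DukeFriedlanderIwaniec1995, Theorem 5 p. 437] -/
theorem dukeFriedlanderIwaniec1995_theorem5_holds : dukeFriedlanderIwaniec1995_theorem5 := by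
  obtain ⟨Cπ, hCπ0, hCπ⟩ := DFI1995.exists_eventually_div_log_le_primeCounting
  refine ⟨max 48 (1207 * Cπ), ?_⟩
  intro ε hε hε12 c hc x₁ A₁ A₂ H34 H35
  by_cases hε24 : 1 / 24 < ε
  · -- the trivial bound
    refine ⟨0, fun x _ => ?_⟩
    have h0 : (0 : ℝ) ≤ Nat.primeCounting ⌊x⌋₊ := Nat.cast_nonneg _
    calc ‖∑ p ∈ Nat.primesLE ⌊x⌋₊, c p‖ ≤ 2 * (Nat.primeCounting ⌊x⌋₊ : ℝ) :=
          DFI1995.norm_primeSum_le_two_mul_primeCounting hc _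
      _ ≤ (48 * ε) * (Nat.primeCounting ⌊x⌋₊ : ℝ) := mul_le_mul_of_nonneg_right (by linarith) h0
      _ ≤ max 48 (1207 * Cπ) * ε * (Nat.primeCounting ⌊x⌋₊ : ℝ) := by
          refine mul_le_mul_of_nonneg_right (mul_le_mul_of_nonneg_right (le_max_left _ _) hε.le) h0
  rw [not_lt] at hε24
  -- thresholds for `log x` and `log log x`
  set T : ℝ := max ((16384 : ℝ) ^ 2) (max (10 * Real.exp 16 / ε) (max (20592 / ε) (max (2680 / ε)
    (max (21280 / ε) (max (2 * |A₁| / ε) (|A₂| / ε)))))) with hT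
  have hevL : ∀ᶠ x : ℝ in atTop, T ≤ Real.log x :=
    Real.tendsto_log_atTop.eventually (eventually_ge_atTop T)
  have hevL2 : ∀ᶠ x : ℝ in atTop, Real.sqrt (16 / (Real.log 2 * ε)) ≤ Real.log (Real.log x) :=
    (Real.tendsto_log_atTop.comp Real.tendsto_log_atTop).eventually (eventually_ge_atTop _)
  have hevlo : ∀ᶠ x : ℝ in atTop, ‖Real.log x‖ ≤ ε / 40 * ‖x ^ (3 * ε)‖ :=
    (isLittleO_log_rpow_atTop (by positivity : 0 < 3 * ε)).bound (by positivity)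
  obtain ⟨x₀, hx₀⟩ := Filter.eventually_atTop.1
    (hevL.and (hevL2.and (hevlo.and (hCπ.and ((eventually_ge_atTop x₁).and (eventually_gt_atTop 1))))))
  refine ⟨x₀, fun x hx => ?_⟩
  obtain ⟨hTL, hL2, hlo, hπ, hxx₁, hx1⟩ := hx₀ x hx
  have hx0 : 0 < x := by linarith
  -- unpack the thresholds
  have hbig1 : (16384 : ℝ) ^ 2 ≤ Real.log x := le_trans (by rw [hT]; simp) hTL
  have hbigt : 10 * Real.exp 16 / ε ≤ Real.log x := le_trans (by rw [hT]; simp) hTL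
  have hbig2 : 20592 / ε ≤ Real.log x := le_trans (by rw [hT]; simp) hTL
  have hbig3 : 2680 / ε ≤ Real.log x := le_trans (by rw [hT]; simp) hTL
  have hbig4 : 21280 / ε ≤ Real.log x := le_trans (by rw [hT]; simp) hTL
  have hbigA₁ : 2 * |A₁| / ε ≤ Real.log x := le_trans (by rw [hT]; simp) hTL
  have hbigA₂ : |A₂| / ε ≤ Real.log x := le_trans (by rw [hT]; simp) hTL
  have hL16 : 16 ≤ Real.log x := le_trans (by norm_num) hbig1
  have hL0 : 0 < Real.log x := by linarith
  have hL128 : 128 ≤ Real.log x := le_trans (by norm_num) hbig1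
  -- the parameters
  obtain ⟨⟨hw2, hwy, hyz, hz4, hzs, hxz, hD0, hDx⟩, hlogy, hlogw, hlogD, hlogz, hy0, hz0⟩ :=
    DFI1995.theorem5_params hε hε24 hx1 hbig1
  have hK : 0 < ⌊Real.log x⌋₊ ^ 5 := pow_pos (Nat.floor_pos.2 (le_trans (by norm_num) hL16)) 5
  -- the junk terms
  have hlo' : Real.log x ≤ ε / 40 * x ^ (3 * ε) := by
    rw [Real.norm_of_nonneg hL0.le, Real.norm_of_nonneg (Real.rpow_nonneg hx0.le _)] at hlo
    exact hlo
  have j1 := DFI1995.junk_z_le hε hε24 hx1 hL16 hlo'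
  have hwin : Real.log (Real.log (Real.sqrt x) / Real.log (x ^ (1 / 2 - 3 * ε / 2) / 2)) +
      16 / Real.log (x ^ (1 / 2 - 3 * ε / 2) / 2) ≤ 6 * ε + 67 / Real.log x := by
    rw [Real.log_sqrt hx0.le, Real.log_div hz0.ne' two_ne_zero, hlogz]
    exact DFI1995.log_window_z_le hε hε24 hL16
  have j2 : 40 * (x / Real.log x) * (Real.log (Real.log (Real.sqrt x) / Real.log (x ^ (1 / 2 - 3 * ε / 2) / 2)) +
      16 / Real.log (x ^ (1 / 2 - 3 * ε / 2) / 2)) ≤ 241 * ε * (x / Real.log x) :=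
    le_trans (mul_le_mul_of_nonneg_left hwin (by positivity)) (DFI1995.junk_window_le hε hx0.le hL0 hbig3)
  have j3 := DFI1995.junk_B1_le (A₁ := A₁) hε hx0.le hL0 hbigA₁
  have hL2' : 8 ≤ Real.log 2 * ε / 2 * Real.log (Real.log x) ^ 2 := by
    have hlog2 : 0 < Real.log 2 := Real.log_pos one_lt_two
    have ha : 0 ≤ 16 / (Real.log 2 * ε) := by positivity
    have h1 : 16 / (Real.log 2 * ε) ≤ Real.log (Real.log x) ^ 2 := by
      have := pow_le_pow_left₀ (Real.sqrt_nonneg _) hL2 2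
      rwa [Real.sq_sqrt ha] at this
    rw [div_le_iff₀ (by positivity)] at h1
    linarith only [h1]
  have j4 := DFI1995.junk_tail_le hε hε24 hx1 hL16 hD0 hz0 hlogw hlogD hlogz hL2' hbigt
  have j5 := DFI1995.junk_middle_le (K := ⌊Real.log x⌋₊ ^ 5) hε hε24 hx1 hbig1 hbig2
    (lt_of_lt_of_le two_pos hw2) hy0 hlogw hlogy rfl
  have j6 := DFI1995.junk_KB_le (A₂ := A₂) hε hx0.le (le_trans (by norm_num) hL16 : (2 : ℝ) ≤ Real.log x) hbigA₂
  have j7 := DFI1995.junk_left_le hε hε24 hx0.le hL128 hbig4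
  -- the master inequality
  have master := DFI1995.norm_primeSum_le_master hc hε hε24 hx1 hL16 hw2 hwy hyz hz4 hzs hxz hlogy hD0
    hDx hK (H34 x hxx₁) (H35 x hxx₁)
  -- combine
  have hπ' : x / Real.log x ≤ Cπ * (Nat.primeCounting ⌊x⌋₊ : ℝ) := hπ
  have hT1 : 2 * (A₁ * x / Real.log x ^ 2) +
      (x * (1 + Real.log x)) * (Real.exp (-(Real.log 2 * Real.log (x ^ (1 / 2 - ε)) /
        Real.log (x ^ ((Real.log (Real.log x))⁻¹ ^ 3)))) *
        Real.exp (4 * (Real.log (Real.log (x ^ ((Real.log (Real.log x))⁻¹ ^ 3))) + 4))) +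
      2 * (x * (1 + Real.log x)) * (Real.log (Real.log x) + 4) *
        (Real.exp (-(Real.log 2 * Real.log (x ^ (1 / 2 - ε) / x ^ (1 / 2 - 3 * ε / 2)) /
          Real.log (x ^ ((Real.log (Real.log x))⁻¹ ^ 3)))) *
          Real.exp (4 * (Real.log (Real.log (x ^ ((Real.log (Real.log x))⁻¹ ^ 3))) + 4))) ≤
      ε * (x / Real.log x) + ε * (x / Real.log x) := by
    rw [add_assoc]
    exact add_le_add j3 j4
  have hsum := master.trans
    (add_le_add (add_le_add (add_le_add (add_le_add le_rfl j2) hT1) (add_le_add j5 j6)) (add_le_add le_rfl j7))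
  calc ‖∑ p ∈ Nat.primesLE ⌊x⌋₊, c p‖ ≤ 1207 * ε * (x / Real.log x) := by
        refine hsum.trans ?_
        linarith only [j1]
    _ ≤ 1207 * ε * (Cπ * (Nat.primeCounting ⌊x⌋₊ : ℝ)) := mul_le_mul_of_nonneg_left hπ' (by positivity)
    _ ≤ max 48 (1207 * Cπ) * ε * (Nat.primeCounting ⌊x⌋₊ : ℝ) := by
        have h0 : (0 : ℝ) ≤ Nat.primeCounting ⌊x⌋₊ := Nat.cast_nonneg _
        have h1 : 1207 * Cπ ≤ max 48 (1207 * Cπ) := le_max_right _ _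
        calc 1207 * ε * (Cπ * (Nat.primeCounting ⌊x⌋₊ : ℝ))
            = (1207 * Cπ) * (ε * (Nat.primeCounting ⌊x⌋₊ : ℝ)) := by ring
          _ ≤ max 48 (1207 * Cπ) * (ε * (Nat.primeCounting ⌊x⌋₊ : ℝ)) :=
              mul_le_mul_of_nonneg_right h1 (mul_nonneg hε.le h0)
          _ = max 48 (1207 * Cπ) * ε * (Nat.primeCounting ⌊x⌋₊ : ℝ) := by ring

end Literature.NumberTheory.Sieve
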